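import Summits.KontsevichZagierPeriods.Zeta5Search.TwoTaleLineBoundBlocks
import Summits.KontsevichZagierPeriods.Zeta5Search.Denom.TwoTaleP15Decay

/-!
# The two-tale point P15: `log ‖R_n‖` on a vertical line as block sums, and its closed-form upper bound

HONEST FRAMING: systematic search; no irrationality claim unless certified.

Cell pub-zeta5, T3 service (P1 g9) for fam-denom's E5 (the line bound behind `Decay c`, `families/denom/P15KERNEL.md`
§6.1).  For fam-denom's complex `ratRC n` (`Denom/TwoTaleP15Decay`) at `s = u + iy`, `y ≠ 0`:

* `norm_add_natCast_I` — `‖(u + i) + iy‖ = √((u+i)² + y²)`, so `log ‖·‖ = halfLog y (u+i)`;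
* **`log_norm_ratRC_eq`** — `log ‖ratRC n (u+iy)‖ =` (three numerator block sums) `−` (denominator block sum) of
  `halfLog y (u + i)` `+ log (11n)! − log (13n)! − log (9n)! − log (5n)!` (exact);
* **`log_norm_ratRC_le`** — the same with every numerator block replaced by its integral in closed form
  (`TwoTaleLineBound.prim`) `+` the two endpoint values `+ (1 + log 2)`, and the denominator block by its integral from
  one node to the left (`sum_halfLog_le`, `le_sum_halfLog`; needs `u + 15n ≥ 0`, true on every line `Re t = x ≥ 0` of the strip
  since `u = x − (11n+1)`).
What is NOT here: Stirling for the four factorials, the `η`-certificate `max_η h(ξ,η) ≤ −c`, the Laplace `dy`-assembly.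
-/

noncomputable section

open Real Finset Complex

namespace Summit.KontsevichZagierPeriods.Zeta5Search.TwoTaleLineBound

open Denom.TwoTaleP15Decay (ratRC)

variable {y : ℝ}

/-- `‖(u + i) + iy‖ = √((u+i)²+y²)` for real `u`, natural `i`, real `y`. -/
theorem norm_real_add_natCast_add_I (u y : ℝ) (i : ℕ) :
    ‖((u : ℂ) + (y : ℂ) * I) + (i : ℂ)‖ = Real.sqrt ((u + i) ^ 2 + y ^ 2) := by
  have h : ((u : ℂ) + (y : ℂ) * I) + (i : ℂ) = ((u + i : ℝ) : ℂ) + (y : ℂ) * I := by push_cast; ring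
  rw [h, Complex.norm_add_mul_I, Real.sqrt_eq_rpow]

/-- `log ‖(u+i) + iy‖ = halfLog y (u+i)` (`y ≠ 0`). -/
theorem log_norm_factor (hy : y ≠ 0) (u : ℝ) (i : ℕ) :
    Real.log ‖((u : ℂ) + (y : ℂ) * I) + (i : ℂ)‖ = halfLog y (u + i) := by
  rw [norm_real_add_natCast_add_I, halfLog, Real.log_sqrt (sq_add_sq_pos hy _).le]

/-- The factors are nonzero for `y ≠ 0`. -/
theorem factor_ne_zero (hy : y ≠ 0) (u : ℝ) (i : ℕ) : ((u : ℂ) + (y : ℂ) * I) + (i : ℂ) ≠ 0 := by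
  intro h
  have := congrArg Complex.im h
  simp at this
  exact hy this

/-- `log ‖∏_{i ∈ s} ((u+iy) + i)‖ = Σ_{i ∈ s} halfLog y (u+i)`. -/
theorem log_norm_prod (hy : y ≠ 0) (u : ℝ) (s : Finset ℕ) :
    Real.log ‖∏ i ∈ s, (((u : ℂ) + (y : ℂ) * I) + (i : ℂ))‖ = ∑ i ∈ s, halfLog y (u + i) := by
  rw [norm_prod, Real.log_prod]
  · exact sum_congr rfl fun i _ => log_norm_factor hy u i
  · intro i _; exact (norm_ne_zero_iff.2 (factor_ne_zero hy u i))

/-- **`log ‖R_n(u+iy)‖` as block sums** (exact, `y ≠ 0`). -/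
theorem log_norm_ratRC_eq (hy : y ≠ 0) (n : ℕ) (u : ℝ) :
    Real.log ‖ratRC n ((u : ℂ) + (y : ℂ) * I)‖ =
      (∑ i ∈ Ico 1 (13 * n + 1), halfLog y (u + i)) + (∑ i ∈ Ico (2 * n + 1) (11 * n + 1), halfLog y (u + i))
        + (∑ i ∈ Ico (4 * n + 1) (9 * n + 1), halfLog y (u + i)) - (∑ i ∈ Ico (15 * n + 1) (26 * n + 2), halfLog y (u + i))
        + Real.log (Nat.factorial (11 * n)) - Real.log (Nat.factorial (13 * n)) - Real.log (Nat.factorial (9 * n))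
        - Real.log (Nat.factorial (5 * n)) := by
  unfold ratRC
  set s : ℂ := (u : ℂ) + (y : ℂ) * I with hs
  have hP : ∀ t : Finset ℕ, ‖∏ i ∈ t, (s + (i : ℂ))‖ ≠ 0 := fun t =>
    norm_ne_zero_iff.2 (prod_ne_zero_iff.2 fun i _ => factor_ne_zero hy u i)
  have hF : ∀ m : ℕ, ‖(Nat.factorial m : ℂ)‖ = (Nat.factorial m : ℝ) := fun m => by
    rw [Complex.norm_natCast]
  have hF0 : ∀ m : ℕ, (Nat.factorial m : ℝ) ≠ 0 := fun m => by exact_mod_cast (Nat.factorial_pos m).ne'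
  rw [norm_mul, norm_mul, norm_mul, norm_div, norm_div, norm_div, norm_div, hF, hF, hF, hF,
    Real.log_mul (mul_ne_zero (mul_ne_zero (div_ne_zero (hP _) (hF0 _)) (div_ne_zero (hP _) (hF0 _)))
      (div_ne_zero (hP _) (hF0 _))) (div_ne_zero (hF0 _) (hP _)),
    Real.log_mul (mul_ne_zero (div_ne_zero (hP _) (hF0 _)) (div_ne_zero (hP _) (hF0 _))) (div_ne_zero (hP _) (hF0 _)),
    Real.log_mul (div_ne_zero (hP _) (hF0 _)) (div_ne_zero (hP _) (hF0 _)),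
    Real.log_div (hP _) (hF0 _), Real.log_div (hP _) (hF0 _), Real.log_div (hP _) (hF0 _), Real.log_div (hF0 _) (hP _),
    log_norm_prod hy, log_norm_prod hy, log_norm_prod hy, log_norm_prod hy]
  ring

/-- A block sum over `Ico lo hi` (naturals, `lo < hi`) as a sum over `range` from the base point `u + lo`. -/
theorem sum_Ico_halfLog (y u : ℝ) {lo hi : ℕ} (h : lo < hi) :
    ∑ i ∈ Ico lo hi, halfLog y (u + i) = ∑ i ∈ range (hi - 1 - lo + 1), halfLog y ((u + lo) + i) := by
  rw [Finset.sum_Ico_eq_sum_range, show hi - lo = hi - 1 - lo + 1 by omega]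
  refine sum_congr rfl fun k _ => ?_
  push_cast; ring_nf

/-- **Closed-form upper bound for `log ‖R_n(u+iy)‖`** (`y ≠ 0`, `n ≥ 1`, `0 ≤ u + 15n`): each numerator block is at
most its integral (`prim` differences) plus its two endpoint values plus `1 + log 2`; the denominator block is at least
its integral started one node to the left. -/
theorem log_norm_ratRC_le (hy : y ≠ 0) {n : ℕ} (hn : 1 ≤ n) {u : ℝ} (hu : 0 ≤ u + 15 * n) :
    Real.log ‖ratRC n ((u : ℂ) + (y : ℂ) * I)‖ ≤
      ((prim y (u + 13 * n) - prim y (u + 1)) + halfLog y (u + 1) + halfLog y (u + 13 * n) + (1 + Real.log 2))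
      + ((prim y (u + 11 * n) - prim y (u + (2 * n + 1))) + halfLog y (u + (2 * n + 1)) + halfLog y (u + 11 * n)
          + (1 + Real.log 2))
      + ((prim y (u + 9 * n) - prim y (u + (4 * n + 1))) + halfLog y (u + (4 * n + 1)) + halfLog y (u + 9 * n)
          + (1 + Real.log 2))
      - (prim y (u + (26 * n + 1)) - prim y (u + 15 * n))
      + Real.log (Nat.factorial (11 * n)) - Real.log (Nat.factorial (13 * n)) - Real.log (Nat.factorial (9 * n))
      - Real.log (Nat.factorial (5 * n)) := by
  rw [log_norm_ratRC_eq hy n u, sum_Ico_halfLog y u (by omega : 1 < 13 * n + 1),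
    sum_Ico_halfLog y u (by omega : 2 * n + 1 < 11 * n + 1), sum_Ico_halfLog y u (by omega : 4 * n + 1 < 9 * n + 1),
    sum_Ico_halfLog y u (by omega : 15 * n + 1 < 26 * n + 2)]
  have h1 := sum_halfLog_le hy (u + (1 : ℕ)) (L := 13 * n + 1 - 1 - 1) (by omega)
  have h2 := sum_halfLog_le hy (u + (2 * n + 1 : ℕ)) (L := 11 * n + 1 - 1 - (2 * n + 1)) (by omega)
  have h3 := sum_halfLog_le hy (u + (4 * n + 1 : ℕ)) (L := 9 * n + 1 - 1 - (4 * n + 1)) (by omega)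
  have h4 := le_sum_halfLog hy (x₀ := u + (15 * n + 1 : ℕ)) (by push_cast; linarith) (26 * n + 2 - 1 - (15 * n + 1))
  have e1 : (u + ((1 : ℕ) : ℝ)) + ((13 * n + 1 - 1 - 1 : ℕ) : ℝ) = u + 13 * n := by
    rw [Nat.cast_sub (by omega), Nat.cast_sub (by omega)]; push_cast; ring
  have e2 : (u + ((2 * n + 1 : ℕ) : ℝ)) + ((11 * n + 1 - 1 - (2 * n + 1) : ℕ) : ℝ) = u + 11 * n := by
    rw [Nat.cast_sub (by omega), Nat.cast_sub (by omega)]; push_cast; ring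
  have e3 : (u + ((4 * n + 1 : ℕ) : ℝ)) + ((9 * n + 1 - 1 - (4 * n + 1) : ℕ) : ℝ) = u + 9 * n := by
    rw [Nat.cast_sub (by omega), Nat.cast_sub (by omega)]; push_cast; ring
  have e4 : (u + ((15 * n + 1 : ℕ) : ℝ)) + ((26 * n + 2 - 1 - (15 * n + 1) : ℕ) : ℝ) = u + (26 * n + 1) := by
    rw [Nat.cast_sub (by omega), Nat.cast_sub (by omega)]; push_cast; ring
  have e4' : (u + ((15 * n + 1 : ℕ) : ℝ)) - 1 = u + 15 * n := by push_cast; ring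
  rw [e1] at h1; rw [e2] at h2; rw [e3] at h3; rw [e4, e4'] at h4
  push_cast at h1 h2 h3 h4 ⊢
  linarith

end Summit.KontsevichZagierPeriods.Zeta5Search.TwoTaleLineBound

end
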